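import Summits.ResolutionOfSingularities.ResolutionOfSingularities.Theorems.HomologicalConductorNoZenoBasePtsCapture
import Summits.ResolutionOfSingularities.ResolutionOfSingularities.Theorems.HomologicalConductorNoZenoExitDivisorReach
import Summits.ResolutionOfSingularities.ResolutionOfSingularities.Theorems.HomologicalConductorNoZenoPrimeDivisorBasePt
import Summits.ResolutionOfSingularities.ResolutionOfSingularities.Theorems.HomologicalConductorNoZenoBasePtsFinite
import HarnessLib

/-!
# Crux `NoZeno` / `NoZenoR` (stmt-ResolutionOfSingularities-16483 / -19943), line `sandwich-cluster`
# (= first-layer stubs of line `birth`, skeleton v10): **S4 `stub_basePtsStrictAnti`**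

Route `ResolutionOfSingularities/HomologicalConductor`.  OURS (cell res-hironaka); nothing here is a
statement of the manuscript under review.  The registered stub S4 of skeleton v10 (lead
res-L0-w44-lead-1; plan-1's text + the hypothesis «`T_(m+1)` singular»): in a sandwich context, under
(Q_val at `m`), if `T_m` has a base point and `T_(m+1)` is not regular, then
`basePts R T_(m+1) ⊂ basePts R T_m`.

Proof (the cluster calculus, valuatively): ⊆ is CAPTURE (`basePts_tower_succ_subset`,
`…BasePtsCapture.lean`).  For strictness take the EXIT DIVISOR `W` of the step (`exists_exitDivisor`,
`…ExitDivisor.lean`: a valuation ring dominating `T_m` but not `T_(m+1)`, residually transcendental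
over `k`, essentially generated by `T_(m+1)`); `W` dominates the regular two-dimensional `R`
(`R ≤ T_m`, `loc O R = R`), so by Zariski's theorem on prime divisors of a two-dimensional regular
local ring (`exists_coe_eq_ordSet_of_isDiscreteValuationRing`, stub-3's `…PrimeDivisorBasePt.lean`: the last
two-dimensional quadratic transform `S'` of `R` along `W` has `E_{S'} = W`) there is a regular
two-dimensional `S' ⊇ R` with `ordSet S' = W`.  Then `S' ∈ basePts R T_m`: `W` dominates `T_m`, and
`¬ T_m ≤ S'` — otherwise CAPTURE (`captureOfPrincipal_of_isRegularLocalRing`, with (Q_val)) gives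
`T_(m+1) ≤ S'`, whence `W ⊆ S'` (denominators of `W` are `W`-units of `T_(m+1)`, inverted in `S'`
by domination) and `dim S' ≤ 1`.  And `S' ∉ basePts R T_(m+1)` since `W` does not dominate `T_(m+1)`.

* `ringKrullDim_le_one_of_forall_mem_or_inv_mem` — a Noetherian local subalgebra which is a
  valuation ring of `K` has dimension `≤ 1`;
* `stub_basePtsStrictAnti` — **S4, v10 text verbatim** (`dim R = 2` from the given base point by
  stub-1's `ringKrullDim_eq_two_of_mem_basePts`; the exit divisor is a DVR essentially of finite
  type over `R` by `…ExitDivisorReach.lean`; Zariski's theorem is stub-3's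
  `exists_coe_eq_ordSet_of_isDiscreteValuationRing`, `…PrimeDivisorBasePt.lean`).

References: J. Lipman, Publ. IHÉS 36 (1969) §12, §18 [`Lipman1969`]; M. Spivakovsky, Ann. of Math.
131 (1990) §II [`Spivakovsky1990`]; O. Zariski, P. Samuel, Commutative Algebra II (1960) App. 5
[`ZariskiSamuel1960`]; S. Abhyankar, Amer. J. Math. 78 (1956) [`Abhyankar1956Valuations`].
-/

noncomputable section

-- single-problem summit: the doubled namespace component `ResolutionOfSingularities` is forced
set_option linter.dupNamespace false

namespace Summit.ResolutionOfSingularities.ResolutionOfSingularities.Theorems.NoZeno.SandwichCluster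

open Summit.ResolutionOfSingularities.ResolutionOfSingularities.Theses.HomologicalConductor
open Summit.ResolutionOfSingularities.ResolutionOfSingularities.Theorems.NoZeno.Birth
open Literature.AlgebraicGeometry.Resolution IsLocalRing Polynomial

variable {k K : Type} [Field k] [Field K] [Algebra k K]

/-! ## Dimension bookkeeping -/

/-- **A Noetherian local `k`-subalgebra of `K` which is a valuation ring of `K` has dimension `≤ 1`**
(it is a principal ideal ring; the `Subring` form is
`Literature.AlgebraicGeometry.Resolution.ringKrullDim_le_one_of_forall_mem_or_inv_mem`). [folklore] -/
theorem ringKrullDim_le_one_of_forall_mem_or_inv_mem (T : Subalgebra k K) [IsNoetherianRing ↥T]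
    [IsLocalRing ↥T] (h : ∀ z : K, z ∈ T ∨ z⁻¹ ∈ T) : ringKrullDim ↥T ≤ 1 := by
  -- adapted from `ringKrullDim_le_one_of_forall_mem_or_inv_mem` (Literature/…/QuadraticTransformsChart.lean)
  haveI : ValuationRing ↥T := by
    refine { cond' := fun a b => ?_ }
    rcases h ((a : K) / b) with hz | hz
    · by_cases hb : (b : K) = 0
      · exact ⟨0, Or.inl (Subtype.ext (by simp [hb]))⟩
      · refine ⟨⟨_, hz⟩, Or.inr (Subtype.ext ?_)⟩
        change (b : K) * (a / b) = a
        field_simp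
    · by_cases ha : (a : K) = 0
      · exact ⟨0, Or.inr (Subtype.ext (by simp [ha]))⟩
      · refine ⟨⟨_, hz⟩, Or.inl (Subtype.ext ?_)⟩
        change (a : K) * ((a : K) / b)⁻¹ = b
        by_cases hb : (b : K) = 0
        · simp [hb]
        · field_simp
  haveI : IsPrincipalIdealRing ↥T :=
    ((tfae_of_isNoetherianRing_of_isLocalRing_of_isDomain ↥T).out 0 1).mpr ‹_›
  rw [← Nat.cast_one, ← Ring.krullDimLE_iff]
  infer_instance

/-! ## S4 -/

/-- **Stub S4 `stub_basePtsStrictAnti`** of skeleton v10 of line `birth` (crux `NoZenoR`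
stmt-ResolutionOfSingularities-19943 / `NoZeno` stmt-16483), registered signature VERBATIM: in a
sandwich context `SandwichCtx O A R m₀`, for `m ≥ m₀ + 1`, under (Q_val at `m`), if `T_m` has a base
point over `R` and `T_(m+1)` is NOT regular, then `basePts R (tower O A (m + 1)) ⊂ basePts R (tower O A m)`
— no new base point (CAPTURE) and an old base point exits (the exit divisor `W` of the step is the
order valuation `E_{S'}` of an infinitely near point `S'` of `R`, which is a base point of `T_m` but
not of `T_(m+1)`).  The hypothesis `hne` is not used (strictness comes from `hsing`).
[cite: Lipman1969, §12, §18; Spivakovsky1990, §II; ZariskiSamuel1960, Appendix 5] -/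
theorem stub_basePtsStrictAnti (p : ℕ) (hp : p.Prime) (k K : Type) [Field k] [CharP k p] [Field K]
    [Algebra k K] (O : ValuationSubring K) (A R : Subalgebra k K) (m₀ : ℕ)
    (ctx : SandwichCtx O A R m₀) (m : ℕ) (hm : m₀ + 1 ≤ m)
    (hQ : ∀ S : Subalgebra k K, tower O A m ≤ S → IsRegularLocalRing ↥S →
      (Ideal.span {s : ↥S | (s : K) ∈ ca (tower O A m)}).IsPrincipal)
    (hne : (basePts R (tower O A m)).Nonempty) (hsing : ¬ IsRegularLocalRing ↥(tower O A (m + 1))) :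
    basePts R (tower O A (m + 1)) ⊂ basePts R (tower O A m) := by
  have _hp := hp
  obtain ⟨S₀, hS₀⟩ := hne
  have hdimR : ringKrullDim ↥R = 2 := ringKrullDim_eq_two_of_mem_basePts O A R m₀ ctx hS₀
  obtain ⟨hk, hA, hfr, hAO, htr, hRreg, hRfr, -, hlocR, hm₀⟩ := ctx
  haveI := hRreg
  haveI := hRfr
  haveI := hfr
  obtain ⟨n, rfl⟩ : ∃ n, m = n + 1 := ⟨m - 1, by omega⟩
  -- ⊆ : capture
  refine ⟨basePts_tower_succ_subset O A R hk hAO (n + 1) hQ, fun hsup => ?_⟩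
  -- the exit divisor of the step: a DVR, essentially of finite type over `R`
  obtain ⟨W, hWtop, hkW, hTW, hgen, hdomT, ⟨t, htT, htW, htT'⟩, htt⟩ :=
    exists_exitDivisor O A hk hA hfr hAO htr n hsing
  haveI : IsDiscreteValuationRing ↥W :=
    isDiscreteValuationRing_of_residuallyTranscendental A hA hfr htr W hWtop hkW htt
  haveI : Algebra.EssFiniteType k ↥(tower O A (n + 1 + 1)) :=
    (tn_tower_invariant O A hk hA hfr hAO (n + 1 + 1)).2.2
  obtain ⟨g, hgW, hWN⟩ := exists_finset_le_locAtCentre W (tower O A (n + 1 + 1)) R hTW hgen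
  have hTT : tower O A (n + 1) ≤ tower O A (n + 1 + 1) :=
    fun s hs => d2rc_mem_tower_of_le O A (Nat.le_succ _) hs
  have hRT : R ≤ tower O A (n + 1) := hm₀ (n + 1) (by omega)
  have hRW : R.toSubring ≤ W.toSubring := fun z hz => hTW (hTT (hRT hz))
  have hdomR : ∀ z ∈ R, z⁻¹ ∈ W → z⁻¹ ∈ R := by
    intro z hz hzW
    have hzT : z⁻¹ ∈ tower O A (n + 1) := hdomT z (hRT hz) hzW
    have hzO : z⁻¹ ∈ O := mem_valuationSubring_of_mem_tower O hk hAO (n + 1) _ hzT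
    rw [← hlocR]
    exact inv_mem_loc O R hz hzO
  -- Zariski: `W = E_{S'}` for an infinitely near point `S'` of `R`
  have hNW : Subring.closure ((R : Set K) ∪ (g : Set K)) ≤ W.toSubring := by
    refine Subring.closure_le.mpr ?_
    rintro z (hz | hz)
    · exact hRW hz
    · exact hgW hz
  obtain ⟨S', hRS', hS'reg, hS'dim, -, -, hWS'⟩ :=
    exists_coe_eq_ordSet_of_isDiscreteValuationRing htr hdimR W hRW hdomR
      (Subring.closure ((R : Set K) ∪ (g : Set K))) hNW g
      (fun z hz => Subring.subset_closure (Or.inr hz)) le_rfl hWN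
  haveI := hS'reg
  haveI : IsFractionRing ↥S' K := isFractionRing_subalgebra_of_le R S' hRS'
  -- `S'` is a base point of `T_m` …
  have hVS : ∀ s : K, s ∈ S' → s ∈ (W : Set K) ∧ (s⁻¹ ∈ (W : Set K) → s⁻¹ ∈ S') := by
    rw [hWS']; exact dominates_ordSet_self S'
  have hmem : S' ∈ basePts R (tower O A (n + 1)) := by
    refine ⟨hRS', hS'reg, hS'dim, fun hle => ?_, ?_⟩
    · -- `¬ T_m ≤ S'`: else CAPTURE gives `T_(m+1) ≤ S'`, then `W ⊆ S'` and `dim S' ≤ 1`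
      have hle' : tower O A (n + 1 + 1) ≤ S' := by
        rw [tower_succ]
        refine captureOfPrincipal_of_isRegularLocalRing O W (tower O A (n + 1)) S' hle hS'reg
          (hQ S' hle hS'reg) hVS ?_
        intro s hs
        rw [← tower_succ] at hs
        exact hTW (Subalgebra.mem_toSubring.mpr hs)
      have hWS : ∀ w ∈ W, w ∈ S' := by
        intro w hw
        obtain ⟨a, ha, s, hs, hsW, rfl⟩ := hgen w hw
        exact S'.mul_mem (hle' ha) ((hVS s (hle' hs)).2 hsW)
      have h1 : ringKrullDim ↥S' ≤ 1 :=
        ringKrullDim_le_one_of_forall_mem_or_inv_mem S' fun z =>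
          (W.mem_or_inv_mem z).imp (hWS z) (hWS z⁻¹)
      rw [hS'dim] at h1
      exact absurd h1 (by decide)
    · -- `ordSet S' = W` dominates `T_m`
      intro s hs
      rw [← hWS']
      exact ⟨hTW (hTT hs), hdomT s hs⟩
  -- … but not of `T_(m+1)`: `W` does not dominate it
  have hnot : S' ∉ basePts R (tower O A (n + 1 + 1)) := by
    rintro ⟨-, -, -, -, hdom'⟩
    have h := (hdom' t htT).2
    rw [← hWS'] at h
    exact htT' (h htW)
  exact hnot (hsup hmem)

end Summit.ResolutionOfSingularities.ResolutionOfSingularities.Theorems.NoZeno.SandwichCluster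

end
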